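import Summits.QuantumFields.YangMills.Theorems.LuscherReductionTwistedTraceScalingBODefect
import Summits.QuantumFields.YangMills.Theorems.FemtoTransferGapRungW1upSite
import HarnessLib

/-!
# SCHUR BOUND FOR THE COLOUR-AVERAGED ONE-SITE KERNEL: `‖K̃₁^{(B)} h‖² ≤ (c_B^{|E|})²·‖h‖²`, `c_B^{|E|} = linkCE B`
# (lane A of S-BASE, crux `TwistedTraceScaling` stmt-QuantumFields-20203, C4-CORE, the (OD) pen, step (C4) of `pub/ym-fleet/ym-luscher-20007-p1/COARSE-DESIGN.md` §27.7)

In the `L²(w)` door (`…BODefect`) the core part of the defect is `η·(K̃₁|φ|)⊗Ω` (`…BOCoreTransfer`), so (C4) needs `∫ (K̃₁|φ|)² ≤ Λ²∫φ²` with `Λ = O(λ₀)`, `K̃₁ = avgKernel B` the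
colour-averaged one-site kernel at `B = L³β`.  This file proves the Schur bound with `Λ = linkCE B` (the free row sum); `linkCE B ≤ 2·levelValue su2Rep 1 B 0` eventually is
`…DressedRitzPolyakovLiftShadowKernelMoment.exists_linkCE_le_two_mul_levelValue_zero`, so `Λ ≤ 2λ₀`.
* ★ `sq_integral_kernel_le` — generic Schur test on a finite measure space: a bounded measurable kernel `k ≥ 0` with row AND column sums `≤ R` satisfies `∫(∫k(x,y)h(y)dy)²dx ≤ R²∫h²`
  (weighted Cauchy–Schwarz `…BODefect.sq_integral_mul_mul_le` fibrewise + Fubini).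
* ★ `integral_avgKernel_one_le_linkCE` — `∫_u K̃₁^{(B)}(u',u) du ≤ linkCE B` (`K_B ≤ E_B` pointwise, `∫E_B = linkCE`, invariance of Haar under the colour action).
* ★★ `sq_integral_avgKernel_one_le` — `∫_{u'} (∫_u K̃₁^{(B)}(u',u)·h(u) du)² du' ≤ (linkCE B)²·∫ h²` for bounded measurable `h`, `B ≥ 0`.
HONEST FRAMING: elementary bookkeeping for a stub of a child of the CONDITIONAL route R2b1; (C1), tails, (B-ST) OPEN; C4-CORE OPEN; not infinite volume, not a gap, not Clay.
-/

set_option autoImplicit false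

noncomputable section

open MeasureTheory Filter Topology Real
open scoped BigOperators
open Literature.MathematicalPhysics.QuantumFieldTheory
open Literature.MathematicalPhysics.QuantumLattice

namespace Summit.QuantumFields.YangMills.Theorems.FemtoTransferGap.TwoLattice.ConstTube

open Summit.QuantumFields.YangMills.Theorems.FemtoTransferGap
open Summit.QuantumFields.YangMills.Theorems.FemtoTransferGap.TwoLattice
open Summit.QuantumFields.YangMills.Theorems.FemtoTransferGap.TwoLattice.Avg

/-! ## §1 The generic Schur test -/

section Schur

variable {X : Type*} [MeasurableSpace X] (μ : Measure X) [IsFiniteMeasure μ]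

/-- ★ **Schur test (squared form).**  For a bounded measurable kernel `k ≥ 0` on a finite measure space whose row sums and column sums are `≤ R`, and a bounded measurable `h`:
`∫ (∫ k(x,y)·h(y) dy)² dx ≤ R²·∫ h²`. [cite: Helffer2013, Lemma 7.1] -/
theorem sq_integral_kernel_le {k : X → X → ℝ} (hk : Measurable (Function.uncurry k)) {Ck : ℝ} (hCk : ∀ x y, |k x y| ≤ Ck) (hk0 : ∀ x y, 0 ≤ k x y)
    {h : X → ℝ} (hh : Measurable h) {Ch : ℝ} (hCh : ∀ y, |h y| ≤ Ch) {R : ℝ} (hR : 0 ≤ R) (hrow : ∀ x, ∫ y, k x y ∂μ ≤ R) (hcol : ∀ y, ∫ x, k x y ∂μ ≤ R) :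
    ∫ x, (∫ y, k x y * h y ∂μ) ^ 2 ∂μ ≤ R ^ 2 * ∫ y, h y ^ 2 ∂μ := by
  have hCh0 : ∀ y : X, 0 ≤ Ch := fun y => (abs_nonneg _).trans (hCh y)
  have hCk0 : ∀ x : X, 0 ≤ Ck := fun x => (abs_nonneg _).trans (hCk x x)
  have hkx : ∀ x, Measurable (k x) := fun x => hk.comp (measurable_const.prodMk measurable_id)
  have hky : ∀ y, Measurable fun x => k x y := fun y => hk.comp (measurable_id.prodMk measurable_const)
  -- fibrewise Cauchy–Schwarz with weight `k(x,·)`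
  have hpt : ∀ x, (∫ y, k x y * h y ∂μ) ^ 2 ≤ R * ∫ y, h y ^ 2 * k x y ∂μ := by
    intro x
    have hcs := sq_integral_mul_mul_le μ (a := fun _ => (1 : ℝ)) (b := h) (w := k x) measurable_const hh (hkx x) (Ca := 1) (fun _ => by rw [abs_one]) hCh (hCk x)
      (fun y => hk0 x y)
    have e1 : ∫ y, (1 : ℝ) * h y * k x y ∂μ = ∫ y, k x y * h y ∂μ := integral_congr_ae (ae_of_all _ fun y => by ring)
    have e2 : ∫ y, (1 : ℝ) ^ 2 * k x y ∂μ = ∫ y, k x y ∂μ := integral_congr_ae (ae_of_all _ fun y => by ring)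
    rw [e1, e2] at hcs
    have hI0 : 0 ≤ ∫ y, h y ^ 2 * k x y ∂μ := integral_nonneg fun y => mul_nonneg (sq_nonneg _) (hk0 x y)
    exact hcs.trans (mul_le_mul_of_nonneg_right (hrow x) hI0)
  -- integrability facts
  have hJm : Measurable (Function.uncurry fun x y => h y ^ 2 * k x y) := ((hh.pow_const 2).comp measurable_snd).mul hk
  have hJb : ∀ p : X × X, |(Function.uncurry fun x y => h y ^ 2 * k x y) p| ≤ Ch ^ 2 * Ck := fun p => by
    simp only [Function.uncurry]
    rw [abs_mul, abs_pow]
    exact mul_le_mul (pow_le_pow_left₀ (abs_nonneg _) (hCh _) 2) (hCk _ _) (abs_nonneg _) (pow_nonneg (hCh0 p.2) 2)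
  have hJint : Integrable (Function.uncurry fun x y => h y ^ 2 * k x y) (μ.prod μ) := integrable_of_measurable_abs_le _ hJm hJb
  have hIm : Measurable fun x => ∫ y, k x y * h y ∂μ := by
    have hm : Measurable (Function.uncurry fun x y => k x y * h y) := hk.mul (hh.comp measurable_snd)
    exact (hm.stronglyMeasurable.integral_prod_right' (ν := μ)).measurable
  have hIb : ∀ x, |∫ y, k x y * h y ∂μ| ≤ Ck * Ch * μ.real Set.univ := fun x => by
    calc |∫ y, k x y * h y ∂μ| ≤ ∫ y, |k x y * h y| ∂μ := abs_integral_le_integral_abs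
      _ ≤ ∫ _y, Ck * Ch ∂μ := integral_mono_of_nonneg (ae_of_all _ fun _ => abs_nonneg _) (integrable_const _) (ae_of_all _ fun y => by
          show |k x y * h y| ≤ Ck * Ch
          rw [abs_mul]; exact mul_le_mul (hCk x y) (hCh y) (abs_nonneg _) (hCk0 x))
      _ = Ck * Ch * μ.real Set.univ := by rw [integral_const, smul_eq_mul, Measure.real]; ring
  have hI2int : Integrable (fun x => (∫ y, k x y * h y ∂μ) ^ 2) μ :=
    integrable_of_measurable_abs_le _ (hIm.pow_const 2) (C := (Ck * Ch * μ.real Set.univ) ^ 2) fun x => by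
      rw [abs_pow]; exact pow_le_pow_left₀ (abs_nonneg _) (hIb x) 2
  have hinner_m : Measurable fun x => ∫ y, h y ^ 2 * k x y ∂μ := (hJm.stronglyMeasurable.integral_prod_right' (ν := μ)).measurable
  have hinner_b : ∀ x, |∫ y, h y ^ 2 * k x y ∂μ| ≤ Ch ^ 2 * Ck * μ.real Set.univ := fun x => by
    calc |∫ y, h y ^ 2 * k x y ∂μ| ≤ ∫ y, |h y ^ 2 * k x y| ∂μ := abs_integral_le_integral_abs
      _ ≤ ∫ _y, Ch ^ 2 * Ck ∂μ := integral_mono_of_nonneg (ae_of_all _ fun _ => abs_nonneg _) (integrable_const _) (ae_of_all _ fun y => hJb (x, y))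
      _ = Ch ^ 2 * Ck * μ.real Set.univ := by rw [integral_const, smul_eq_mul, Measure.real]; ring
  have hinner_int : Integrable (fun x => ∫ y, h y ^ 2 * k x y ∂μ) μ := integrable_of_measurable_abs_le _ hinner_m hinner_b
  -- integrate the fibrewise bound and swap
  calc ∫ x, (∫ y, k x y * h y ∂μ) ^ 2 ∂μ ≤ ∫ x, R * ∫ y, h y ^ 2 * k x y ∂μ ∂μ := integral_mono hI2int (hinner_int.const_mul R) hpt
    _ = R * ∫ y, ∫ x, h y ^ 2 * k x y ∂μ ∂μ := by rw [integral_const_mul, integral_integral_swap hJint]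
    _ = R * ∫ y, h y ^ 2 * ∫ x, k x y ∂μ ∂μ := by
        congr 1; exact integral_congr_ae (ae_of_all _ fun y => by dsimp only; rw [integral_const_mul])
    _ ≤ R * ∫ y, h y ^ 2 * R ∂μ := by
        refine mul_le_mul_of_nonneg_left ?_ hR
        have hcm : Measurable fun y => ∫ x, k x y ∂μ := (hk.stronglyMeasurable.integral_prod_left' (μ := μ)).measurable
        have hcb : ∀ y, |∫ x, k x y ∂μ| ≤ Ck * μ.real Set.univ := fun y => by
          calc |∫ x, k x y ∂μ| ≤ ∫ x, |k x y| ∂μ := abs_integral_le_integral_abs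
            _ ≤ ∫ _x, Ck ∂μ := integral_mono_of_nonneg (ae_of_all _ fun _ => abs_nonneg _) (integrable_const _) (ae_of_all _ fun x => hCk x y)
            _ = Ck * μ.real Set.univ := by rw [integral_const, smul_eq_mul, Measure.real]; ring
        refine integral_mono (integrable_of_measurable_abs_le _ ((hh.pow_const 2).mul hcm) (C := Ch ^ 2 * (Ck * μ.real Set.univ)) fun y => ?_)
          (integrable_of_measurable_abs_le _ ((hh.pow_const 2).mul measurable_const) (C := Ch ^ 2 * |R|) fun y => ?_) fun y => ?_
        · rw [abs_mul, abs_pow]; exact mul_le_mul (pow_le_pow_left₀ (abs_nonneg _) (hCh _) 2) (hcb y) (abs_nonneg _) (pow_nonneg (hCh0 y) 2)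
        · rw [abs_mul, abs_pow]; exact mul_le_mul (pow_le_pow_left₀ (abs_nonneg _) (hCh _) 2) le_rfl (abs_nonneg _) (pow_nonneg (hCh0 y) 2)
        · exact mul_le_mul_of_nonneg_left (hcol y) (sq_nonneg _)
    _ = R ^ 2 * ∫ y, h y ^ 2 ∂μ := by rw [integral_mul_const]; ring

end Schur

/-! ## §2 Row sums of the colour-averaged one-site kernel -/

/-- ★ **`∫_u K̃₁^{(B)}(u', u) du ≤ linkCE B`** (`B ≥ 0`): the colour average does not change the row sum (invariance of Haar), and `K_B ≤ E_B` with `∫ E_B = linkCE B`.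
[folklore] -/
theorem integral_avgKernel_one_le_linkCE {B : ℝ} (hB : 0 ≤ B) (u' : GaugeConfig 3 1 SU2) :
    ∫ u, avgKernel B u' u ∂configMeasure SU2 1 ≤ linkCE B := by
  haveI : IsProbabilityMeasure (gaugeMeasure 1) := by unfold gaugeMeasure; infer_instance
  obtain ⟨M, hM⟩ := exists_transferKernel_le su2Rep continuous_su2Rep B (L := 1)
  -- joint integrand `(u, g) ↦ K_B(u', u^g)`
  have hK : Measurable fun q : GaugeConfig 3 1 SU2 × GaugeConfig 3 1 SU2 => transferKernel su2Rep B q.1 q.2 :=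
    (continuous_transferKernel su2Rep continuous_su2Rep B).measurable
  have hJm : Measurable fun p : GaugeConfig 3 1 SU2 × (Site 3 1 → SU2) => transferKernel su2Rep B u' (gaugeTransform p.2 p.1) := by
    have hc : Measurable fun _ : GaugeConfig 3 1 SU2 × (Site 3 1 → SU2) => u' := measurable_const
    have h := hK.comp (hc.prodMk (measurable_gaugeAction (L := 1)))
    simpa only [Function.comp_def] using h
  have hJb : ∀ p : GaugeConfig 3 1 SU2 × (Site 3 1 → SU2), |transferKernel su2Rep B u' (gaugeTransform p.2 p.1)| ≤ M :=
    fun p => by rw [abs_of_pos (transferKernel_pos su2Rep B _ _)]; exact hM _ _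
  have hJint : Integrable (fun p : GaugeConfig 3 1 SU2 × (Site 3 1 → SU2) => transferKernel su2Rep B u' (gaugeTransform p.2 p.1))
      ((configMeasure SU2 1).prod (gaugeMeasure 1)) := integrable_of_measurable_abs_le _ hJm hJb
  have hswap : ∫ u, ∫ g, transferKernel su2Rep B u' (gaugeTransform g u) ∂gaugeMeasure 1 ∂configMeasure SU2 1 =
      ∫ g, ∫ u, transferKernel su2Rep B u' (gaugeTransform g u) ∂configMeasure SU2 1 ∂gaugeMeasure 1 := by
    rw [← integral_prod _ hJint, integral_prod_symm _ hJint]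
  unfold avgKernel
  rw [hswap]
  have hg : ∀ g : Site 3 1 → SU2, ∫ u, transferKernel su2Rep B u' (gaugeTransform g u) ∂configMeasure SU2 1 ≤ linkCE B := by
    intro g
    rw [integral_comp_eq_of_measurePreserving (measurePreserving_gaugeTransform_configMeasure g) (F := fun u => transferKernel su2Rep B u' u)
      (measurable_transferKernel_left B u')]
    have hEm : Measurable fun u : GaugeConfig 3 1 SU2 => linkE B u' u := ((continuous_linkE B).comp (continuous_const.prodMk continuous_id)).measurable
    calc ∫ u, transferKernel su2Rep B u' u ∂configMeasure SU2 1 ≤ ∫ u, linkE B u' u ∂configMeasure SU2 1 :=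
          integral_mono_of_nonneg (ae_of_all _ fun u => (transferKernel_pos su2Rep B _ _).le) (integrable_of_measurable_abs_le _ hEm (abs_linkE_le hB u'))
            (ae_of_all _ fun u => transferKernel_le_linkE hB u' u)
      _ = linkCE B := integral_linkE_snd B u'
  calc ∫ g, ∫ u, transferKernel su2Rep B u' (gaugeTransform g u) ∂configMeasure SU2 1 ∂gaugeMeasure 1 ≤ ∫ _g, linkCE B ∂gaugeMeasure 1 :=
        integral_mono_of_nonneg (ae_of_all _ fun g => integral_nonneg fun u => (transferKernel_pos su2Rep B _ _).le) (integrable_const _) (ae_of_all _ hg)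
    _ = linkCE B := by simp

/-! ## §3 ★★ The Schur bound for `K̃₁` -/

/-- ★★ **`∫_{u'} (∫_u K̃₁^{(B)}(u',u)·h(u) du)² du' ≤ (linkCE B)²·∫ h²`** for bounded measurable `h` and `B ≥ 0`. [cite: Helffer2013, Lemma 7.1] -/
theorem sq_integral_avgKernel_one_le {B : ℝ} (hB : 0 ≤ B) {h : GaugeConfig 3 1 SU2 → ℝ} (hh : Measurable h) {Ch : ℝ} (hCh : ∀ u, |h u| ≤ Ch) :
    ∫ u', (∫ u, avgKernel B u' u * h u ∂configMeasure SU2 1) ^ 2 ∂configMeasure SU2 1 ≤ linkCE B ^ 2 * ∫ u, h u ^ 2 ∂configMeasure SU2 1 := by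
  obtain ⟨M, hM0, hM⟩ := exists_avgKernel_le (L := 1) B
  refine sq_integral_kernel_le (configMeasure SU2 1) (k := fun u' u => avgKernel B u' u) (measurable_avgKernel (L := 1) B) (Ck := M)
    (fun u' u => by rw [abs_of_pos (avgKernel_pos B _ _)]; exact hM _ _) (fun u' u => (avgKernel_pos B _ _).le) hh hCh (linkCE_pos hB).le
    (fun u' => integral_avgKernel_one_le_linkCE hB u') fun u => ?_
  have e : (fun u' => avgKernel B u' u) = fun u' => avgKernel B u u' := funext fun u' => avgKernel_symm B u' u
  rw [e]; exact integral_avgKernel_one_le_linkCE hB u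

end Summit.QuantumFields.YangMills.Theorems.FemtoTransferGap.TwoLattice.ConstTube

end
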